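import Literature.Probability.Percolation.QuadCrossingSpaceProofs
import Literature.Topology.PlaneTopology.RectangleDuality
import HarnessLib

/-!
# Plane topology of a quad: boundary = the four sides, the crossing lemma, the dual path

Topic `Probability/Percolation`; proofs file next to `QuadCrossingSpaceProofs.lean`, transporting
the rectangle lemmas of `Literature/Topology/PlaneTopology/RectangleDuality.lean` to an arbitrary
quad `Q ∈ 𝒬_D` (Schramm–Smirnov's topological quadrilaterals, `QuadCrossingSpace.lean`) through
the extension of `Q` to a homeomorphism of the plane (`Quad.exists_homeomorph_extend`, the
Schoenflies theorem for `2`-cells).  These are the topological inputs of the RSW / lowest-crossing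
/ duality arguments for crossings of GENERAL quads — first of all of Schramm–Smirnov's continuity
Lemma 6.1 (`SchrammSmirnov2011_lemma_6_1`, O. Schramm, S. Smirnov, *On the scaling limits of
planar percolation*, Ann. Probab. 39 (2011), arXiv:1101.5820, §6: "Any crossing of `Q'` …
passes within distance `δ` of `τ`"; "Hence, there is a dual closed crossing from `∂₃Q` …").
All statements are chart-free:

* `Quad.frontier_carrier` — **`∂[Q] = ∂₀Q ∪ ∂₁Q ∪ ∂₂Q ∪ ∂₃Q`**; `Quad.interior_carrier_eq_image` —
  the interior of `[Q]` is the image of the open square; `Quad.isOpen_image_interiorSquare`.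
* `Quad.exists_transpose` — the transposed quad `(x, y) ↦ Q(y, x)` (same carrier, sides
  `0 ↔ 1`, `2 ↔ 3`), used to get each lemma in both orientations.
* `Quad.exists_mem_of_isPreconnected_crossing` — **crossing lemma**: a compact connected
  `K ⊆ [Q]` meeting `∂₀Q` and `∂₂Q` meets every path in `[Q]` from `∂₁Q` to `∂₃Q`
  (and `Quad.exists_mem_of_isPreconnected_crossing'`, sides `1, 3` versus `0, 2`).
* `Quad.exists_path_avoiding_of_not_crossed` — **the dual path**: if a compact `𝒦 ⊆ [Q]` has no
  connected subset meeting `∂₀Q` and `∂₂Q`, some path in `[Q]` joins `∂₁Q` to `∂₃Q` off `𝒦`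
  (and the primed version with the sides exchanged).

## References

* O. Schramm, S. Smirnov, Ann. Probab. 39 (2011) 1768–1814, arXiv:1101.5820, §1.3 and proof of
  Lemma 6.1. [SchrammSmirnov2011]
-/

noncomputable section

open scoped unitInterval
open Set Filter Metric Function Complex
open _root_.Topology
open Literature.Topology.PlaneTopology

namespace Literature.Probability.Percolation

namespace QuadCrossing

variable {D : Set ℂ}

namespace Quad

/-! ### The chart and the extension: coordinates of side points -/

/-- The sides as images of the edges of the square (definitional unfoldings). [cite: SchrammSmirnov2011, §1.3] -/
theorem side_zero_eq (Q : Quad D) : Q.side 0 = Q '' {z : I × I | z.1 = 0} := rfl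

/-- `side_one_eq`: structural lemma (definitional unfolding of `Quad.side`). [cite: SchrammSmirnov2011, §1.3] -/
theorem side_one_eq (Q : Quad D) : Q.side 1 = Q '' {z : I × I | z.2 = 0} := rfl

/-- `side_two_eq`: structural lemma (definitional unfolding of `Quad.side`). [cite: SchrammSmirnov2011, §1.3] -/
theorem side_two_eq (Q : Quad D) : Q.side 2 = Q '' {z : I × I | z.1 = 1} := rfl

/-- `side_three_eq`: structural lemma (definitional unfolding of `Quad.side`). [cite: SchrammSmirnov2011, §1.3] -/
theorem side_three_eq (Q : Quad D) : Q.side 3 = Q '' {z : I × I | z.2 = 1} := rfl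

/-- Coordinates of the chart point: `re = 2x - 1`, `im = 2y - 1`; hence `re = -1 ↔ x = 0`,
`re = 1 ↔ x = 1`, `im = -1 ↔ y = 0`, `im = 1 ↔ y = 1`. [folklore] -/
theorem chart_re_im (p : I × I) :
    (((2 * (p.1 : ℝ) - 1 : ℝ) : ℂ) + ((2 * (p.2 : ℝ) - 1 : ℝ) : ℂ) * Complex.I).re =
        2 * (p.1 : ℝ) - 1 ∧
      (((2 * (p.1 : ℝ) - 1 : ℝ) : ℂ) + ((2 * (p.2 : ℝ) - 1 : ℝ) : ℂ) * Complex.I).im =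
        2 * (p.2 : ℝ) - 1 :=
  re_im_ofReal_add_ofReal_mul_I _ _

/-- **Straightening a quad.** There are a plane homeomorphism `H` and a continuous `c : ℂ → [0,1]²`
such that `[Q] = H([-1,1]²)`, `H⁻¹(Q p)` is the chart point of `p`, `c` inverts the chart on
`[-1,1]²`, and the four sides of `Q` are the `H`-images of the four edges of `[-1,1]²`:
`∂₀Q ↔ re = -1`, `∂₁Q ↔ im = -1`, `∂₂Q ↔ re = 1`, `∂₃Q ↔ im = 1`.
[cite: SchrammSmirnov2011, proof of Lemma 5.1 (the extension `Q̂₀`)] -/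
theorem exists_straighten (Q : Quad D) :
    ∃ H : ℂ ≃ₜ ℂ,
      (∀ p : I × I, H.symm (Q p) =
        (((2 * (p.1 : ℝ) - 1 : ℝ) : ℂ) + ((2 * (p.2 : ℝ) - 1 : ℝ) : ℂ) * Complex.I)) ∧
      Q.carrier = H '' (Icc (-1 : ℝ) 1 ×ℂ Icc (-1 : ℝ) 1) ∧
      Q.side 0 = H '' {z | z ∈ Icc (-1 : ℝ) 1 ×ℂ Icc (-1 : ℝ) 1 ∧ z.re = -1} ∧
      Q.side 1 = H '' {z | z ∈ Icc (-1 : ℝ) 1 ×ℂ Icc (-1 : ℝ) 1 ∧ z.im = -1} ∧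
      Q.side 2 = H '' {z | z ∈ Icc (-1 : ℝ) 1 ×ℂ Icc (-1 : ℝ) 1 ∧ z.re = 1} ∧
      Q.side 3 = H '' {z | z ∈ Icc (-1 : ℝ) 1 ×ℂ Icc (-1 : ℝ) 1 ∧ z.im = 1} := by
  obtain ⟨H, hH⟩ := exists_homeomorph_extend Q
  obtain ⟨c, -, hce, hec⟩ := exists_chart
  have hsymm : ∀ p : I × I, H.symm (Q p) =
      (((2 * (p.1 : ℝ) - 1 : ℝ) : ℂ) + ((2 * (p.2 : ℝ) - 1 : ℝ) : ℂ) * Complex.I) := fun p => by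
    rw [← hH p, Homeomorph.symm_apply_apply]
  -- a side/edge correspondence, uniformly in a predicate on the chart coordinates
  have key : ∀ (P : I × I → Prop) (R : ℂ → Prop),
      (∀ p : I × I, P p ↔ R (((2 * (p.1 : ℝ) - 1 : ℝ) : ℂ) + ((2 * (p.2 : ℝ) - 1 : ℝ) : ℂ) * Complex.I)) →
      Q '' {z | P z} = H '' {z | z ∈ Icc (-1 : ℝ) 1 ×ℂ Icc (-1 : ℝ) 1 ∧ R z} := by
    intro P R hPR
    ext w
    constructor
    · rintro ⟨p, hp, rfl⟩
      exact ⟨_, ⟨chart_mem_rect p, (hPR p).1 hp⟩, hH p⟩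
    · rintro ⟨z, ⟨hz, hR⟩, rfl⟩
      refine ⟨c z, ?_, ?_⟩
      · rw [Set.mem_setOf_eq, hPR (c z), hec z hz]
        exact hR
      · rw [← hH (c z), hec z hz]
  refine ⟨H, hsymm, ?_, ?_, ?_, ?_, ?_⟩
  · -- carrier
    have := key (fun _ => True) (fun _ => True) (fun p => Iff.rfl)
    simp only [and_true, setOf_mem_eq] at this
    rw [← this]
    ext w
    simp [Quad.carrier]
  · rw [side_zero_eq]
    refine key _ _ fun p => ?_
    rw [(chart_re_im p).1]
    constructor
    · intro h; rw [h]; norm_num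
    · intro h
      exact Subtype.ext (by simpa using (by linarith : (p.1 : ℝ) = 0))
  · rw [side_one_eq]
    refine key _ _ fun p => ?_
    rw [(chart_re_im p).2]
    constructor
    · intro h; rw [h]; norm_num
    · intro h
      exact Subtype.ext (by simpa using (by linarith : (p.2 : ℝ) = 0))
  · rw [side_two_eq]
    refine key _ _ fun p => ?_
    rw [(chart_re_im p).1]
    constructor
    · intro h; rw [h]; norm_num
    · intro h
      exact Subtype.ext (by simpa using (by linarith : (p.1 : ℝ) = 1))
  · rw [side_three_eq]
    refine key _ _ fun p => ?_
    rw [(chart_re_im p).2]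
    constructor
    · intro h; rw [h]; norm_num
    · intro h
      exact Subtype.ext (by simpa using (by linarith : (p.2 : ℝ) = 1))

/-! ### Boundary and interior of `[Q]` -/

/-- The boundary of the square `[-1,1]²` is the union of its four edges. [folklore] -/
theorem frontier_square_eq :
    frontier (Icc (-1 : ℝ) 1 ×ℂ Icc (-1 : ℝ) 1) =
      {z | z ∈ Icc (-1 : ℝ) 1 ×ℂ Icc (-1 : ℝ) 1 ∧ z.re = -1} ∪
      {z | z ∈ Icc (-1 : ℝ) 1 ×ℂ Icc (-1 : ℝ) 1 ∧ z.im = -1} ∪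
      {z | z ∈ Icc (-1 : ℝ) 1 ×ℂ Icc (-1 : ℝ) 1 ∧ z.re = 1} ∪
      {z | z ∈ Icc (-1 : ℝ) 1 ×ℂ Icc (-1 : ℝ) 1 ∧ z.im = 1} := by
  rw [frontier_reProdIm, closure_Icc, frontier_Icc (by norm_num : (-1 : ℝ) ≤ 1)]
  ext z
  simp only [mem_union, mem_reProdIm, mem_Icc, mem_insert_iff, mem_singleton_iff, mem_setOf_eq]
  constructor
  · rintro (⟨hre, him | him⟩ | ⟨hre | hre, him⟩)
    · exact Or.inl (Or.inl (Or.inr ⟨⟨hre, by rw [him]; norm_num⟩, him⟩))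
    · exact Or.inr ⟨⟨hre, by rw [him]; norm_num⟩, him⟩
    · exact Or.inl (Or.inl (Or.inl ⟨⟨by rw [hre]; norm_num, him⟩, hre⟩))
    · exact Or.inl (Or.inr ⟨⟨by rw [hre]; norm_num, him⟩, hre⟩)
  · rintro (((⟨⟨-, him⟩, hre⟩ | ⟨⟨hre, -⟩, him⟩) | ⟨⟨-, him⟩, hre⟩) | ⟨⟨hre, -⟩, him⟩)
    · exact Or.inr ⟨Or.inl hre, him⟩
    · exact Or.inl ⟨hre, Or.inl him⟩
    · exact Or.inr ⟨Or.inr hre, him⟩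
    · exact Or.inl ⟨hre, Or.inr him⟩

/-- **The boundary of a quad is the union of its four sides**: `∂[Q] = ∂₀Q ∪ ∂₁Q ∪ ∂₂Q ∪ ∂₃Q`
(transport of `frontier_square_eq` by the straightening homeomorphism).
[cite: SchrammSmirnov2011, §1.3] -/
theorem frontier_carrier (Q : Quad D) :
    frontier Q.carrier = Q.side 0 ∪ Q.side 1 ∪ Q.side 2 ∪ Q.side 3 := by
  obtain ⟨H, -, hcar, h0, h1, h2, h3⟩ := Q.exists_straighten
  rw [hcar, ← H.image_frontier, frontier_square_eq, image_union, image_union, image_union,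
    ← h0, ← h1, ← h2, ← h3]

/-- Each side lies on the boundary of `[Q]`. [cite: SchrammSmirnov2011, §1.3] -/
theorem side_subset_frontier (Q : Quad D) (k : Fin 4) : Q.side k ⊆ frontier Q.carrier := by
  rw [frontier_carrier]
  match k with
  | 0 => exact subset_union_left.trans (subset_union_left.trans subset_union_left)
  | 1 => exact subset_union_right.trans (subset_union_left.trans subset_union_left)
  | 2 => exact subset_union_right.trans subset_union_left
  | 3 => exact subset_union_right

/-- **The interior of a quad is the image of the open square** `(0,1)²`.
[cite: SchrammSmirnov2011, §1.3] -/
theorem interior_carrier_eq_image (Q : Quad D) :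
    interior Q.carrier =
      Q '' {z : I × I | (z.1 : ℝ) ∈ Ioo (0 : ℝ) 1 ∧ (z.2 : ℝ) ∈ Ioo (0 : ℝ) 1} := by
  obtain ⟨H, hsymm, hcar, -⟩ := Q.exists_straighten
  rw [hcar, ← H.image_interior, interior_reProdIm, interior_Icc]
  ext w
  constructor
  · rintro ⟨z, hz, rfl⟩
    have hz' : z ∈ Icc (-1 : ℝ) 1 ×ℂ Icc (-1 : ℝ) 1 := by
      rw [mem_reProdIm] at hz ⊢
      exact ⟨Ioo_subset_Icc_self hz.1, Ioo_subset_Icc_self hz.2⟩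
    have hw : H z ∈ Q.carrier := hcar ▸ mem_image_of_mem H hz'
    obtain ⟨p, hp⟩ := hw
    refine ⟨p, ?_, hp⟩
    have hzp : z = (((2 * (p.1 : ℝ) - 1 : ℝ) : ℂ) + ((2 * (p.2 : ℝ) - 1 : ℝ) : ℂ) * Complex.I) := by
      rw [← hsymm p, hp, Homeomorph.symm_apply_apply]
    rw [hzp, mem_reProdIm, (chart_re_im p).1, (chart_re_im p).2, mem_Ioo, mem_Ioo] at hz
    exact ⟨⟨by linarith [hz.1.1], by linarith [hz.1.2]⟩, ⟨by linarith [hz.2.1], by linarith [hz.2.2]⟩⟩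
  · rintro ⟨p, ⟨h1, h2⟩, rfl⟩
    refine ⟨H.symm (Q p), ?_, by rw [Homeomorph.apply_symm_apply]⟩
    rw [hsymm p, mem_reProdIm, (chart_re_im p).1, (chart_re_im p).2, mem_Ioo, mem_Ioo]
    exact ⟨⟨by linarith [h1.1], by linarith [h1.2]⟩, ⟨by linarith [h2.1], by linarith [h2.2]⟩⟩

/-- The image of the open square under a quad is open in the plane (invariance of domain for
quads, via the Schoenflies extension). [cite: SchrammSmirnov2011, §1.3] -/
theorem isOpen_image_interiorSquare (Q : Quad D) :
    IsOpen (Q '' {z : I × I | (z.1 : ℝ) ∈ Ioo (0 : ℝ) 1 ∧ (z.2 : ℝ) ∈ Ioo (0 : ℝ) 1}) := by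
  rw [← interior_carrier_eq_image]
  exact isOpen_interior

/-- `[Q]` is the closure of its interior. [cite: SchrammSmirnov2011, §1.3] -/
theorem closure_interior_carrier (Q : Quad D) : closure (interior Q.carrier) = Q.carrier := by
  obtain ⟨H, -, hcar, -⟩ := Q.exists_straighten
  rw [hcar, ← H.image_interior, ← H.image_closure, interior_reProdIm, interior_Icc,
    closure_reProdIm, closure_Ioo (by norm_num : (-1 : ℝ) ≠ 1)]

/-- The interior of `[Q]` is connected and nonempty. [cite: SchrammSmirnov2011, §1.3] -/
theorem isConnected_interior_carrier (Q : Quad D) : IsConnected (interior Q.carrier) := by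
  obtain ⟨H, -, hcar, -⟩ := Q.exists_straighten
  rw [hcar, ← H.image_interior, interior_reProdIm, interior_Icc]
  refine IsConnected.image ?_ H H.continuous.continuousOn
  have hne : (Ioo (-1 : ℝ) 1 ×ℂ Ioo (-1 : ℝ) 1).Nonempty := ⟨0, by simp [mem_reProdIm]⟩
  have hconv : Convex ℝ (Ioo (-1 : ℝ) 1 ×ℂ Ioo (-1 : ℝ) 1) := by
    rw [← (convex_Ioo (𝕜 := ℝ) (-1 : ℝ) 1).convexHull_eq, ← Complex.convexHull_reProdIm]
    exact convex_convexHull ℝ _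
  exact ⟨hne, hconv.isPreconnected⟩

/-! ### The transposed quad -/

/-- **The transposed quad** `(x, y) ↦ Q(y, x)` has the same carrier and exchanges the sides
`0 ↔ 1`, `2 ↔ 3`.  (Used to obtain every two-sided statement in both orientations.) [folklore] -/
theorem exists_transpose (Q : Quad D) :
    ∃ Qt : Quad D, Qt.carrier = Q.carrier ∧ Qt.side 0 = Q.side 1 ∧ Qt.side 1 = Q.side 0 ∧
      Qt.side 2 = Q.side 3 ∧ Qt.side 3 = Q.side 2 := by
  let Qt : Quad D :=
    { toFun := fun p => Q (p.2, p.1)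
      continuous_toFun := Q.continuous_toFun.comp (continuous_snd.prodMk continuous_fst)
      injective_toFun := fun p q h => by
        have := Q.injective_toFun h
        simp only [Prod.mk.injEq] at this
        exact Prod.ext this.2 this.1
      range_subset := by
        rintro _ ⟨p, rfl⟩
        exact Q.range_subset ⟨(p.2, p.1), rfl⟩ }
  have hswap : ∀ (P : I × I → Prop), (fun p : I × I => Q (p.2, p.1)) '' {z | P z} =
      Q '' {z | P (z.2, z.1)} := fun P => by
    ext w
    constructor
    · rintro ⟨p, hp, rfl⟩
      exact ⟨(p.2, p.1), by simpa using hp, rfl⟩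
    · rintro ⟨p, hp, rfl⟩
      exact ⟨(p.2, p.1), hp, rfl⟩
  refine ⟨Qt, ?_, hswap (fun z => z.1 = 0), hswap (fun z => z.2 = 0), hswap (fun z => z.1 = 1),
    hswap (fun z => z.2 = 1)⟩
  ext w
  constructor
  · rintro ⟨p, rfl⟩
    exact ⟨(p.2, p.1), rfl⟩
  · rintro ⟨p, rfl⟩
    exact ⟨(p.2, p.1), rfl⟩

/-! ### The crossing lemma and the dual path for a quad -/

/-- **Crossing lemma for a quad (continuum versus path).**  A compact connected `K ⊆ [Q]`
meeting `∂₀Q` and `∂₂Q` meets every path in `[Q]` from `∂₁Q` to `∂₃Q`.  (Schramm–Smirnov's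
crossings are such continua; this is why a closed dual path between the two other sides excludes
an open crossing, and why "any crossing of `Q'` … passes within distance `δ` of `τ`".)  Transport
of `exists_mem_of_isPreconnected_crossing` (rectangles) by `exists_straighten`.
[cite: SchrammSmirnov2011, §1.3 and proof of Lemma 6.1] -/
theorem exists_mem_of_isPreconnected_crossing (Q : Quad D) {K : Set ℂ} (hK : IsCompact K)
    (hKc : IsPreconnected K) (hKsub : K ⊆ Q.carrier) (hK0 : (K ∩ Q.side 0).Nonempty)
    (hK2 : (K ∩ Q.side 2).Nonempty) {β : ℝ → ℂ} (hβ : ContinuousOn β (Icc 0 1))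
    (hβQ : MapsTo β (Icc 0 1) Q.carrier) (hβ0 : β 0 ∈ Q.side 1) (hβ1 : β 1 ∈ Q.side 3) :
    ∃ t ∈ Icc (0 : ℝ) 1, β t ∈ K := by
  obtain ⟨H, -, hcar, h0, h1, h2, h3⟩ := Q.exists_straighten
  have hpre : ∀ {w : ℂ}, w ∈ Q.carrier → H.symm w ∈ Icc (-1 : ℝ) 1 ×ℂ Icc (-1 : ℝ) 1 := by
    intro w hw
    rw [hcar] at hw
    obtain ⟨z, hz, rfl⟩ := hw
    rwa [Homeomorph.symm_apply_apply]
  have hside : ∀ {w : ℂ} {R : ℂ → Prop},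
      w ∈ H '' {z | z ∈ Icc (-1 : ℝ) 1 ×ℂ Icc (-1 : ℝ) 1 ∧ R z} → R (H.symm w) := by
    rintro w R ⟨z, ⟨-, hR⟩, rfl⟩
    rwa [Homeomorph.symm_apply_apply]
  obtain ⟨t, ht, hmem⟩ := Literature.Topology.PlaneTopology.exists_mem_of_isPreconnected_crossing
    (K := H.symm '' K) (β := fun t => H.symm (β t)) (by norm_num : (-1 : ℝ) ≤ 1)
    (by norm_num : (-1 : ℝ) ≤ 1) (hK.image H.symm.continuous)
    (hKc.image _ H.symm.continuous.continuousOn) (fun _ ⟨w, hw, hzw⟩ => hzw ▸ hpre (hKsub hw))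
    (by obtain ⟨w, hwK, hw0⟩ := hK0
        exact ⟨H.symm w, mem_image_of_mem _ hwK, hside (h0 ▸ hw0)⟩)
    (by obtain ⟨w, hwK, hw2⟩ := hK2
        exact ⟨H.symm w, mem_image_of_mem _ hwK, hside (h2 ▸ hw2)⟩)
    (H.symm.continuous.comp_continuousOn hβ) (fun t ht => hpre (hβQ ht))
    (hside (h1 ▸ hβ0)) (hside (h3 ▸ hβ1))
  obtain ⟨w, hwK, hw⟩ := hmem
  exact ⟨t, ht, H.symm.injective hw ▸ hwK⟩

/-- **Crossing lemma, transposed**: a compact connected `K ⊆ [Q]` meeting `∂₁Q` and `∂₃Q` meets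
every path in `[Q]` from `∂₀Q` to `∂₂Q`. [cite: SchrammSmirnov2011, §1.3 and proof of Lemma 6.1] -/
theorem exists_mem_of_isPreconnected_crossing' (Q : Quad D) {K : Set ℂ} (hK : IsCompact K)
    (hKc : IsPreconnected K) (hKsub : K ⊆ Q.carrier) (hK1 : (K ∩ Q.side 1).Nonempty)
    (hK3 : (K ∩ Q.side 3).Nonempty) {β : ℝ → ℂ} (hβ : ContinuousOn β (Icc 0 1))
    (hβQ : MapsTo β (Icc 0 1) Q.carrier) (hβ0 : β 0 ∈ Q.side 0) (hβ1 : β 1 ∈ Q.side 2) :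
    ∃ t ∈ Icc (0 : ℝ) 1, β t ∈ K := by
  obtain ⟨Qt, hcar, ht0, ht1, ht2, ht3⟩ := Q.exists_transpose
  exact Qt.exists_mem_of_isPreconnected_crossing hK hKc (hcar ▸ hKsub) (ht0 ▸ hK1) (ht2 ▸ hK3)
    hβ (hcar ▸ hβQ) (ht1 ▸ hβ0) (ht3 ▸ hβ1)

/-- **The dual path in a quad.**  If a compact `𝒦 ⊆ [Q]` contains no connected subset meeting
both `∂₀Q` and `∂₂Q`, then some path in `[Q]` joins `∂₁Q` to `∂₃Q` without meeting `𝒦` ("The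
event `¬⊞_Q` would imply … Hence, there is a dual closed crossing", the continuum form of planar
duality).  Transport of `exists_path_avoiding_of_not_crossed` (rectangles) by `exists_straighten`.
[cite: SchrammSmirnov2011, proof of Lemma 6.1] -/
theorem exists_path_avoiding_of_not_crossed (Q : Quad D) {𝒦 : Set ℂ} (h𝒦 : IsCompact 𝒦)
    (h𝒦sub : 𝒦 ⊆ Q.carrier)
    (h : ∀ C ⊆ 𝒦, IsPreconnected C → (C ∩ Q.side 0).Nonempty → (C ∩ Q.side 2).Nonempty → False) :
    ∃ γ : ℝ → ℂ, ContinuousOn γ (Icc 0 1) ∧ MapsTo γ (Icc 0 1) Q.carrier ∧ γ 0 ∈ Q.side 1 ∧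
      γ 1 ∈ Q.side 3 ∧ ∀ t ∈ Icc (0 : ℝ) 1, γ t ∉ 𝒦 := by
  obtain ⟨H, -, hcar, h0, h1, h2, h3⟩ := Q.exists_straighten
  have hpre : ∀ {w : ℂ}, w ∈ Q.carrier → H.symm w ∈ Icc (-1 : ℝ) 1 ×ℂ Icc (-1 : ℝ) 1 := by
    intro w hw
    rw [hcar] at hw
    obtain ⟨z, hz, rfl⟩ := hw
    rwa [Homeomorph.symm_apply_apply]
  obtain ⟨γ, hγc, hγm, hγ0, hγ1, hγ𝒦⟩ :=
    Literature.Topology.PlaneTopology.exists_path_avoiding_of_not_crossed (𝒦 := H.symm '' 𝒦)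
      (by norm_num : (-1 : ℝ) < 1) (by norm_num : (-1 : ℝ) < 1) (h𝒦.image H.symm.continuous)
      (fun _ ⟨w, hw, hzw⟩ => hzw ▸ hpre (h𝒦sub hw)) (fun C hC hCc hCa hCb => by
        refine h (H '' C) ?_ (hCc.image _ H.continuous.continuousOn) ?_ ?_
        · rintro _ ⟨z, hz, rfl⟩
          obtain ⟨w, hw, rfl⟩ := hC hz
          rwa [Homeomorph.apply_symm_apply]
        · obtain ⟨z, hzC, hza⟩ := hCa
          refine ⟨H z, mem_image_of_mem H hzC, ?_⟩
          rw [h0]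
          obtain ⟨w, hw, rfl⟩ := hC hzC
          exact ⟨_, ⟨hpre (h𝒦sub hw), hza⟩, rfl⟩
        · obtain ⟨z, hzC, hzb⟩ := hCb
          refine ⟨H z, mem_image_of_mem H hzC, ?_⟩
          rw [h2]
          obtain ⟨w, hw, rfl⟩ := hC hzC
          exact ⟨_, ⟨hpre (h𝒦sub hw), hzb⟩, rfl⟩)
  refine ⟨fun t => H (γ t), H.continuous.comp_continuousOn hγc, fun t ht => ?_, ?_, ?_,
    fun t ht hmem => hγ𝒦 t ht ?_⟩
  · rw [hcar]
    exact mem_image_of_mem H (hγm ht)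
  · rw [h1]
    exact ⟨γ 0, ⟨hγm (left_mem_Icc.2 zero_le_one), hγ0⟩, rfl⟩
  · rw [h3]
    exact ⟨γ 1, ⟨hγm (right_mem_Icc.2 zero_le_one), hγ1⟩, rfl⟩
  · obtain ⟨w, hw, hwz⟩ := (show H (γ t) ∈ 𝒦 from hmem)  |> fun hm => (⟨H (γ t), hm, rfl⟩ :
      H.symm (H (γ t)) ∈ H.symm '' 𝒦)
    rw [Homeomorph.symm_apply_apply] at hwz
    rw [← hwz]
    exact mem_image_of_mem _ hw

/-- **The dual path, transposed**: if a compact `𝒦 ⊆ [Q]` contains no connected subset meeting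
both `∂₁Q` and `∂₃Q`, some path in `[Q]` joins `∂₀Q` to `∂₂Q` off `𝒦`.
[cite: SchrammSmirnov2011, proof of Lemma 6.1] -/
theorem exists_path_avoiding_of_not_crossed' (Q : Quad D) {𝒦 : Set ℂ} (h𝒦 : IsCompact 𝒦)
    (h𝒦sub : 𝒦 ⊆ Q.carrier)
    (h : ∀ C ⊆ 𝒦, IsPreconnected C → (C ∩ Q.side 1).Nonempty → (C ∩ Q.side 3).Nonempty → False) :
    ∃ γ : ℝ → ℂ, ContinuousOn γ (Icc 0 1) ∧ MapsTo γ (Icc 0 1) Q.carrier ∧ γ 0 ∈ Q.side 0 ∧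
      γ 1 ∈ Q.side 2 ∧ ∀ t ∈ Icc (0 : ℝ) 1, γ t ∉ 𝒦 := by
  obtain ⟨Qt, hcar, ht0, ht1, ht2, ht3⟩ := Q.exists_transpose
  obtain ⟨γ, hγc, hγm, hγ0, hγ1, hγ𝒦⟩ := Qt.exists_path_avoiding_of_not_crossed h𝒦
    (hcar ▸ h𝒦sub) (fun C hC hCc hC0 hC2 => h C hC hCc (ht0 ▸ hC0) (ht2 ▸ hC2))
  exact ⟨γ, hγc, hcar ▸ hγm, ht1 ▸ hγ0, ht3 ▸ hγ1, hγ𝒦⟩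

end Quad

end QuadCrossing

end Literature.Probability.Percolation
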